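import Summits.Ventures.CertifiedManyBodySolver.Observables.DWaveOrderParameterCeilingUniform
import Literature.MathematicalPhysics.QuantumLattice.InfVolFermionStateParticleHoleHubbardEnergy
import Literature.MathematicalPhysics.QuantumLattice.InfVolFermionStateParticleHolePairAmplitude
import HarnessLib

/-!
# OP1-C in IDENTITY FORM, part 7: at the MOTT point `μ = U/2` (`t' = 0`) the CANONICAL (density-1) one-point cell already
# bounds the grand-canonical order parameter `m⋆(U/2)` and the pair LRO of ALL large half-filled tori — by particle–hole
# symmetrisation of the ground-state class

HONEST FRAMING: soundness / bookkeeping theorems for a CEILING route at positivity scale; a ceiling never speaks to the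
presence of pairing; not a superconductivity verdict; nothing in this file is a number. Crew hubbard-obs (D-0042), seat
hubbard-obs-p1 (`prover-hubbard-obs-p1-g12-0`), PAIRCORR-SDP §20. Zero compute; no definition; no named fact; no `sorry`.

Part 6 (`DWaveOrderParameterCeilingUniform`) showed that ONE grand-canonical one-point certificate at `μ' = U/2` (no filling row)
bounds `m⋆(U/2)` and the torus pair LRO of all large half-filled tori. Here the filling row is RESTORED: at `t' = 0`, `μ = U/2`
the class of translation-invariant mean-energy minimisers of `H^{t,0,U} − (U/2)N` is mapped to itself by the staggered
particle–hole transformation (`IsMeanEnergyMinimiser.particleHole_halfCoupling`), the real part of the `d`-wave pair amplitude is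
invariant (`re_particleHole_expect_localPairAt_dWave`) and the density goes to `2 − ρ`; the even mixture `½(ω + ω∘α)` is a
minimiser of density EXACTLY `1` with the same `Re ω(P₀^d)` (`IsMeanEnergyMinimiser.mix_particleHole_halfCoupling`). Hence the
supremum of `Re ω(P₀^d)` over ALL translation-invariant ground states at `μ = U/2` equals the supremum over the DENSITY-1 ones:

* `dWaveOrderParameterTT'_halfCoupling_le_of_densityCell` — a density-1 identity-form cell sentence at a cell containing `U/2`
  (the shape of `ObsPairLROCeilingAt_halfFilling_of_groundStateClass_cell`, part 2: canonical filling row `ρ = 1`, cap `e(1,0,U,1) ≤ u`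
  on `H` alone, charged rows at the grid point, EXACT when `Δ = 0`) gives **`m⋆(t' = 0, U; μ = U/2) ≤ M`**;
* `exists_forall_sectorGroundStates_torusDiagonal_le_halfFilling_of_densityCell` — and the L-UNIFORM torus ceiling: `∀ ε > 0 ∃ L₀
  ∀ L ≥ L₀`, every unit half-filled sector ground state of `hubbardTorusTT' L 1 0 U` has `L⁻⁴ Re⟨ψ, Δ_d†Δ_d ψ⟩ ≤ M² + ε`
  (the leaf `ObsPairLROCeilingAt 0 U 1 c'` is part 2's `ObsPairLROCeilingAt_halfFilling_of_groundStateClass_cell`).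
So the «OP1-GC-MOTT» object (hubbard-obs RULING (go) d233) may KEEP the canonical filling row `n_{0σ} = 1/2` and the canonical cap
`L(h) ≤ hi(#472)` — i.e. it is the cell's row-24-class one-point program at the anchor `(U, 1, 0)` with the charged stationarity rows
written EXACTLY at `μ' = U/2` — and still certify the order-parameter and uniform-torus sentences.

References: T. Koma, H. Tasaki, CMP 158 (1993) 191, Thm 7.3 [KomaTasaki1993]; J. Stat. Phys. 76 (1994) 745, §1 [KomaTasaki1994];
E. H. Lieb, PRL 62 (1989) 1201 [LiebPRL1989]; E. H. Lieb, F. Y. Wu, Physica A 321 (2003) 1, §7 [LiebWuPhysicaA2003];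
O. Bratteli, A. Kishimoto, D. W. Robinson, CMP 64 (1978) 41, Thm. 2 [BratteliKishimotoRobinson1978].
-/

noncomputable section

namespace Summit.Ventures.CertifiedManyBodySolver.Observables

open Matrix Complex Finset Literature.MathematicalPhysics.QuantumLattice Literature.Probability.LatticeModels
open Literature.MathematicalPhysics.QuantumLattice.HubbardWave0 ThermodynamicLimit Filter Topology Set
open scoped ComplexOrder ComplexConjugate BigOperators

section HalfFillingCanonical

/-- **`m⋆(U/2) ≤ M` from a DENSITY-1 one-point cell at the Mott point** (`t' = 0`, `U ≥ 0`): a certified half-filling cap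
`e(1,0,U,1) ≤ u`, a cell `(μg, Δg)` with `|μg − U/2| ≤ Δg` (the degenerate cell `μg = U/2`, `Δg = 0` allowed: charged rows exact),
and the identity-form density-1 cell sentence «every translation-invariant minimiser of `H^{t,0,U} − μ_c N`, `|μg − μ_c| ≤ Δg`, of
density `1` with `e^{t,0,U}(ω) ≤ u` has `Re ω(P₀^d) ≤ M`» give `dWaveOrderParameterTT' 0 U (U/2) ≤ M`: the maximising ground state at
`μ = U/2` is particle–hole symmetrised to density `1` without changing `Re ω(P₀^d)`.
[cite: KomaTasaki1994, §1] [cite: LiebPRL1989, proof of Theorem 2] [cite: LiebWuPhysicaA2003, §7] -/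
theorem dWaveOrderParameterTT'_halfCoupling_le_of_densityCell {U : ℝ} (hU : 0 ≤ U) {u : ℝ}
    (hu : energyDensityTT' 1 0 U 1 ≤ u) (μg Δg M : ℝ) (hnear : |μg - U / 2| ≤ Δg)
    (hcell : ∀ μc : ℝ, |μg - μc| ≤ Δg → ∀ ω : InfVolFermionState 2,
      ω.IsMeanEnergyMinimiser (hubbardTTPrimeSourcedInteraction 1 0 U μc dWaveFormFactor 0) 1 →
      ω.density = 1 → ω.meanEnergy (hubbardTTPrimeFermionInteraction 1 0 U) 1 ≤ u →
        (ω.expect (pairRegion (insert (0 : Site 2) unitSteps) 0)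
          (localPairAt (insert (0 : Site 2) unitSteps) dWaveFormFactor 0)).re ≤ M) :
    dWaveOrderParameterTT' 0 U (U / 2) ≤ M := by
  obtain ⟨ω, hω, hωe⟩ := exists_isMeanEnergyMinimiser_two_mul_re_expect_localPairAt_eq_neg_rightDeriv 0 U (U / 2) 0
  have hmin : ω.IsMeanEnergyMinimiser (hubbardTTPrimeMuInteraction 1 0 U (U / 2)) 1 := by
    rw [← hubbardTTPrimeSourcedInteraction_zero_source 1 0 U (U / 2) dWaveFormFactor]; exact hω
  obtain ⟨hmix, hρ⟩ := hmin.mix_particleHole_halfCoupling 1 U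
  have hmix' : (InfVolFermionState.mix (1 / 2) (by norm_num) (by norm_num) ω ω.particleHole).IsMeanEnergyMinimiser
      (hubbardTTPrimeSourcedInteraction 1 0 U (U / 2) dWaveFormFactor 0) 1 := by
    rw [hubbardTTPrimeSourcedInteraction_zero_source]; exact hmix
  have he : (InfVolFermionState.mix (1 / 2) (by norm_num) (by norm_num) ω ω.particleHole).meanEnergy
      (hubbardTTPrimeFermionInteraction 1 0 U) 1 ≤ u :=
    (meanEnergy_le_energyDensityTT'_of_isMeanEnergyMinimiser_hubbardTTPrimeMu hU zero_le_one one_lt_two hmix hρ).trans hu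
  have hc := hcell (U / 2) hnear _ hmix' hρ he
  have hre : ((InfVolFermionState.mix (1 / 2) (by norm_num) (by norm_num) ω ω.particleHole).expect
        (pairRegion (insert (0 : Site 2) unitSteps) 0)
        (localPairAt (insert (0 : Site 2) unitSteps) dWaveFormFactor 0)).re =
      (ω.expect (pairRegion (insert (0 : Site 2) unitSteps) 0)
        (localPairAt (insert (0 : Site 2) unitSteps) dWaveFormFactor 0)).re := by
    rw [InfVolFermionState.mix_expect, Complex.add_re, Complex.re_ofReal_mul, Complex.re_ofReal_mul,
      ω.re_particleHole_expect_localPairAt_dWave]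
    ring
  rw [hre] at hc
  rw [dWaveOrderParameterTT'_eq_neg_half_rightDeriv]
  linarith

/-- **ALL LARGE HALF-FILLED TORI from a DENSITY-1 one-point cell at the Mott point** (`t' = 0`, `U ≥ 0`; hypotheses of
`dWaveOrderParameterTT'_halfCoupling_le_of_densityCell`): `∀ ε > 0 ∃ L₀ ∀ L ≥ L₀`, EVERY unit ground state `ψ` of `hubbardTorusTT' L 1 0 U`
in the half-filled sector `(rectN 1 L, S^z = 0)` has `L⁻⁴ Re⟨ψ, Δ_d†Δ_d ψ⟩ ≤ M² + ε` — ONE supporting chemical potential suffices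
(`TorusPairLROCeiling.exists_forall_sectorGroundStates_torusDiagonal_le_at`) and `U/2` is one (`half_mem_Icc_chemPot_one`).
[cite: KomaTasaki1993, Theorem 7.3] [cite: LiebWuPhysicaA2003, §7] -/
theorem exists_forall_sectorGroundStates_torusDiagonal_le_halfFilling_of_densityCell {U : ℝ} (hU : 0 ≤ U) {u : ℝ}
    (hu : energyDensityTT' 1 0 U 1 ≤ u) (μg Δg M : ℝ) (hnear : |μg - U / 2| ≤ Δg)
    (hcell : ∀ μc : ℝ, |μg - μc| ≤ Δg → ∀ ω : InfVolFermionState 2,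
      ω.IsMeanEnergyMinimiser (hubbardTTPrimeSourcedInteraction 1 0 U μc dWaveFormFactor 0) 1 →
      ω.density = 1 → ω.meanEnergy (hubbardTTPrimeFermionInteraction 1 0 U) 1 ≤ u →
        (ω.expect (pairRegion (insert (0 : Site 2) unitSteps) 0)
          (localPairAt (insert (0 : Site 2) unitSteps) dWaveFormFactor 0)).re ≤ M)
    {ε : ℝ} (hε : 0 < ε) :
    ∃ L₀ : ℕ, ∀ (L : ℕ) [NeZero L], L₀ ≤ L → ∀ ψ : Fock (Orb (FermionTorus 2 L)), star ψ ⬝ᵥ ψ = 1 →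
      IsGroundStateInSector (hubbardTorusTT' L 1 0 U) (rectN 1 L) 0 ψ →
      torusDiagonal dWaveFormFactor L ψ ≤ M ^ 2 + ε := by
  have hm := dWaveOrderParameterTT'_halfCoupling_le_of_densityCell hU hu μg Δg M hnear hcell
  have hsq : dWaveOrderParameterTT' 0 U (U / 2) ^ 2 ≤ M ^ 2 :=
    pow_le_pow_left₀ (dWaveOrderParameterTT'_nonneg 0 U (U / 2)) hm 2
  exact TorusPairLROCeiling.exists_forall_sectorGroundStates_torusDiagonal_le_at 0 hU one_pos one_lt_two
    (half_mem_Icc_chemPot_one 1 hU) hsq hε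

end HalfFillingCanonical

end Summit.Ventures.CertifiedManyBodySolver.Observables

end
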